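import Summits.Ventures.CertifiedQuantumChemistry.Rows.OccupationVectorMasks
import HarnessLib

/-!
# Ventures/CertifiedQuantumChemistry — Rows/SlaterCondonFast.lean: a bit-mask Slater–Condon evaluator PROVED equal to
# `Model.slaterCondon` (GMP-accelerated kernel evaluation of `⟨I| H_F |J⟩`)

HONEST FRAMING (verbatim): certified bounds for a stated model Hamiltonian in a stated basis; not a
claim about the real molecule beyond that model.

var-2 (gen 16), zero compute, PROVED glue only (0 sorry, no claim node; nothing here asserts a bound about any model).
`Rows/CIUpperBound.lean` (typer) gives the exact rational matrix element `F.slaterCondon I J = ⟨I| H_F |J⟩` on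
occupation sets `I J : Finset (Orb (Fin k))`, by cases on the excitation class, and its bridge to `F.hamiltonian`. This
file gives the SAME number computed on bit masks (`Rows/OccupationBitmasks.lean`, `Rows/OccupationVectorMasks.lean`):

* `FastTables` — scaled INTEGER integral accessors on spatial indices (`H p q = D·h_pq`, `V p q r s = D·(pq|rs)`,
  `E = 2D·E_core`; an instance file supplies them, e.g. as packed-literal look-ups, and decides the agreement
  hypothesis `hA` entry by entry — no named predicate); `h1` / `g2` = the spin-orbital integrals at bit positions.
* `FastTables.diag s`, `single s va vb`, `double s vI vJ vK vL` — `2D ×` the three Slater–Condon cases (`scDiag`,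
  `scSingle`, `scDouble`) on a mask `s` with one-bit position masks `v = 2^(pos P)`: Jordan–Wigner phases by the byte-table
  popcount `pc24` of `s &&& (v − 1)`, `erase`/`insert` by `^^^ v`, orbital sums by the position loop `sumPos`, indices
  by `idx24`; `FastTables.sc m m'` — the case split of `Model.slaterCondon` read off `lowBit` tests on the masks
  `m &&& (m ^^^ m')`, `m' &&& (m ^^^ m')` of `I \ J`, `J \ I` (`scOne`, `scTwo`).
* the row loop `rowTail` / `fastRow` over a CI vector `ciOf k n mask coef = Σ_i coef i · |onv (mask i)⟩` given by `ℕ`-indexed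
  masks and integer coefficients, far pairs skipped by `far4` (four `x &&& (x − 1)` steps leave a bit ⇔ ≥ 5 set bits);
* the three case bridges `diag_eq`, `single_eq`, `double_eq` under the agreement hypothesis `hA`, and the element
  extraction lemmas `exists_orb_of_card_eq_one` / `exists_orb_of_card_eq_two` for one- and two-bit masks.
All DEFINITIONS of the fast route live in this file; the companion files are theorems only.

PART 2 = `Rows/SlaterCondonFastBridge.lean`: **`FastTables.sc_eq`** (`(T.sc m m' : ℚ) = 2·D·F.slaterCondon (onv k m)
(onv k m')` for all masks below `2^(2k)`) and the far-pair guard `far4`. All integer arithmetic; no `let` in the evaluator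
(computed values are passed to auxiliary definitions so the kernel shares them). Row feed and entry points:
`Rows/CIFastRows.lean`.
-/

namespace Summit.Ventures.CertifiedQuantumChemistry

open Finset
open Literature.MathematicalPhysics.QuantumLattice Literature.MathematicalPhysics.QuantumChemistry

/-- Scaled integer integral tables of a model, by spatial orbital index (supplied by an instance file). -/
structure FastTables where
  /-- number of spin-orbital bit positions (`2k`) -/
  B : ℕ
  /-- `D · h_pq` -/
  H : ℕ → ℕ → ℤ
  /-- `D · (pq|rs)` -/
  V : ℕ → ℕ → ℕ → ℕ → ℤ
  /-- `2D · E_core` -/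
  E : ℤ

/-- The CI trial vector of integer mask / coefficient data: `Σ_{i<n} coef i · |onv (mask i)⟩`. -/
def ciOf (k n : ℕ) (mask : ℕ → ℕ) (coef : ℕ → ℤ) : CIVec k n :=
  ⟨fun i => Onv.onv k (mask i.val), fun i => (coef i.val : ℚ)⟩

namespace FastTables

variable {k : ℕ} (T : FastTables)

/-- Spin-orbital one-electron integral at bit positions: `D · h1`. -/
def h1 (P Q : ℕ) : ℤ := if P % 2 = Q % 2 then T.H (P / 2) (Q / 2) else 0

/-- Spin-orbital two-electron integral at bit positions: `D · g2`. -/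
def g2 (P Q R S : ℕ) : ℤ := if P % 2 = Q % 2 ∧ R % 2 = S % 2 then T.V (P / 2) (Q / 2) (R / 2) (S / 2) else 0

/-- `2D · scDiag (onv s)`. -/
def diag (s : ℕ) : ℤ :=
  2 * Onv.sumPos s (fun P => T.h1 P P) T.B +
    Onv.sumPos s (fun P => Onv.sumPos s (fun R => T.g2 P P R R - T.g2 P R R P) T.B) T.B + T.E

/-- `(−1)^n` as an integer. -/
def sgn (n : ℕ) : ℤ := if n % 2 = 0 then 1 else -1

/-- Jordan–Wigner count: set bits of `s` below the position of the one-bit mask `v`. -/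
def jwCount (s v : ℕ) : ℕ := Onv.pc24 (s &&& (v - 1))

/-- `2D · scSingle`, positions supplied: `a b` = positions of the one-bit masks `va vb`. -/
def singleIdx (s va vb a b : ℕ) : ℤ :=
  sgn (jwCount s vb + jwCount (s ^^^ vb) va) *
    (2 * T.h1 a b + Onv.sumPos s (fun R => (T.g2 a b R R + T.g2 R R a b) - (T.g2 a R R b + T.g2 R b a R)) T.B)

/-- `2D · scSingle (onv s) a b` for one-bit masks `va = 2^(pos a)`, `vb = 2^(pos b)`. -/
def single (s va vb : ℕ) : ℤ := T.singleIdx s va vb (Onv.idx24 va) (Onv.idx24 vb)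

/-- `2D · scDouble`, positions supplied. -/
def doubleIdx (s vI vJ vK vL I J K L : ℕ) : ℤ :=
  sgn (jwCount s vK + jwCount (s ^^^ vK) vL + jwCount ((s ^^^ vK) ^^^ vL) vJ +
      jwCount (((s ^^^ vK) ^^^ vL) ^^^ vJ) vI) *
    ((T.g2 I K J L - T.g2 I L J K) - (T.g2 J K I L - T.g2 J L I K))

/-- `2D · scDouble (onv s) I J K L` for one-bit masks `vI vJ vK vL`. -/
def double (s vI vJ vK vL : ℕ) : ℤ :=
  T.doubleIdx s vI vJ vK vL (Onv.idx24 vI) (Onv.idx24 vJ) (Onv.idx24 vK) (Onv.idx24 vL)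

/-- Two-replacement test on the residual masks `a2 = a ^^^ lowBit a`, `b2 = b ^^^ lowBit b`. -/
def scTwo (s va a2 vb b2 : ℕ) : ℤ :=
  if a2 ≠ 0 ∧ b2 ≠ 0 ∧ Onv.lowBit a2 = a2 ∧ Onv.lowBit b2 = b2 then T.double s va a2 vb b2 else 0

/-- One-replacement test on the masks `a`, `b` of `I \ J`, `J \ I`. -/
def scOne (s a b : ℕ) : ℤ :=
  if a ≠ 0 ∧ b ≠ 0 ∧ Onv.lowBit a = a ∧ Onv.lowBit b = b then T.single s a b
  else T.scTwo s (Onv.lowBit a) (a ^^^ Onv.lowBit a) (Onv.lowBit b) (b ^^^ Onv.lowBit b)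

/-- **The fast Slater–Condon element** `2D · ⟨onv m| H_F |onv m'⟩`. -/
def sc (m m' : ℕ) : ℤ := if m = m' then T.diag m else T.scOne m' (m &&& (m ^^^ m')) (m' &&& (m ^^^ m'))

/-! ## The row loop (far pairs skipped; bridges in `Rows/SlaterCondonFastBridge.lean`, `Rows/CIFastRows.lean`) -/

/-- Clear the lowest set bit. -/
def clear1 (x : ℕ) : ℕ := x &&& (x - 1)

/-- `far4 x = true` iff `x` has at least five set bits (four `clear1` steps do not exhaust it). -/
def far4 (x : ℕ) : Bool := clear1 (clear1 (clear1 (clear1 x))) != 0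

/-- Inner loop of a row: `Σ_{j = j0}^{j0 + fuel − 1} [¬ far4 (m ^^^ mask j)] · coef j · sc m (mask j)`. -/
def rowTail (mask : ℕ → ℕ) (coef : ℕ → ℤ) (m : ℕ) : ℕ → ℕ → ℤ
  | _, 0 => 0
  | j, fuel + 1 =>
    (if far4 (m ^^^ mask j) then 0 else coef j * T.sc m (mask j)) + rowTail mask coef m (j + 1) fuel

/-- Row `i < n` of the upper-triangle numerator at scale `2D`:
`coef i · (coef i · sc(m_i, m_i) + 2 · Σ_{i<j<n} [¬far] coef j · sc(m_i, m_j))`. -/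
def fastRow (mask : ℕ → ℕ) (coef : ℕ → ℤ) (n i : ℕ) : ℤ :=
  coef i * (coef i * T.sc (mask i) (mask i) + 2 * T.rowTail mask coef (mask i) (i + 1) (n - (i + 1)))

/-! ## The bridge, case by case -/

section Bridge

variable {T} {F : Model k} {D : ℚ}

/-- `(sgn n : ℚ) = (−1)^n`. -/
theorem cast_sgn (n : ℕ) : ((sgn n : ℤ) : ℚ) = (-1) ^ n := by
  unfold sgn
  rcases Nat.even_or_odd n with h | h
  · rw [if_pos (Nat.even_iff.1 h), h.neg_one_pow]; simp
  · rw [if_neg (by rw [Nat.odd_iff.1 h]; decide), h.neg_one_pow]; simp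

/-- Cardinality of a set difference of occupation vectors as a popcount-able mask. -/
theorem card_sdiff_onv (m m' : ℕ) (hm : m < 2 ^ (2 * k)) :
    (Onv.onv k m \ Onv.onv k m').card = (Onv.bitSet (m &&& (m ^^^ m')) (2 * k)).card ∧
      m &&& (m ^^^ m') < 2 ^ (2 * k) := by
  rw [Onv.onv_sdiff', Onv.card_onv]
  exact ⟨rfl, lt_of_le_of_lt Nat.and_le_left hm⟩

/-- A mask with ONE set bit, as an element: `a = 2^(pos P)` with `onv a = {P}`. -/
theorem exists_orb_of_card_eq_one {a : ℕ} (ha : a < 2 ^ (2 * k)) (h1 : (Onv.bitSet a (2 * k)).card = 1) :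
    ∃ P : Orb (Fin k), a = 2 ^ Onv.pos P ∧ Onv.onv k a = {P} := by
  have ha0 : a ≠ 0 := by rintro rfl; simp [Onv.bitSet_zero] at h1
  have hlow := (Onv.card_bitSet_eq_one_iff ha0 ha).1 h1
  obtain ⟨j, rfl⟩ := Onv.eq_two_pow_of_lowBit_eq ha0 hlow
  have hj : j < 2 * k := by
    by_contra hc
    exact absurd ha (not_lt.2 (Nat.pow_le_pow_right (by norm_num) (not_lt.1 hc)))
  exact ⟨Onv.orbAt k j hj, by rw [Onv.pos_orbAt], Onv.onv_two_pow hj⟩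

/-- A mask with TWO set bits, as elements: `lowBit a = 2^(pos P)`, `a ^^^ lowBit a = 2^(pos Q)`, `P < Q`,
`onv a = {P, Q}`. -/
theorem exists_orb_of_card_eq_two {a : ℕ} (ha : a < 2 ^ (2 * k)) (h2 : (Onv.bitSet a (2 * k)).card = 2) :
    ∃ P Q : Orb (Fin k), Onv.lowBit a = 2 ^ Onv.pos P ∧ a ^^^ Onv.lowBit a = 2 ^ Onv.pos Q ∧ P < Q ∧
      Onv.onv k a = {P, Q} := by
  have ha0 : a ≠ 0 := by rintro rfl; simp [Onv.bitSet_zero] at h2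
  have hne : Onv.lowBit a ≠ a := fun h => by
    have := (Onv.card_bitSet_eq_one_iff ha0 ha).2 h; omega
  have hlow2 := (Onv.card_bitSet_eq_two_iff ha0 ha hne).1 h2
  obtain ⟨i, c, rfl⟩ := Onv.exists_decomp ha0
  obtain ⟨hi, -⟩ := Onv.decomp_bounds ha
  have h2i := Nat.two_pow_pos i
  rw [Onv.lowBit_of_decomp, Onv.decomp_xor_low] at hlow2 ⊢
  have hc0 : 2 ^ (i + 1) * c ≠ 0 := by
    intro h; apply hne; rw [Onv.lowBit_of_decomp]; omega
  obtain ⟨j, hj⟩ := Onv.eq_two_pow_of_lowBit_eq hc0 hlow2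
  have h2j := Nat.two_pow_pos j
  have hij : i < j := by
    by_contra hle
    have h1 : (2 ^ j).testBit j = true := Nat.testBit_two_pow_self
    rw [← hj, Nat.testBit_two_pow_mul] at h1
    simp at h1; omega
  have hj2 : j < 2 * k := by
    by_contra hc
    have h3 : 2 ^ (2 * k) ≤ 2 ^ j := Nat.pow_le_pow_right (by norm_num) (not_lt.1 hc)
    have h4 : 2 ^ j ≤ 2 ^ (i + 1) * c + 2 ^ i := by rw [← hj]; omega
    omega
  refine ⟨Onv.orbAt k i (by omega), Onv.orbAt k j hj2, by rw [Onv.pos_orbAt], by rw [hj, Onv.pos_orbAt], ?_, ?_⟩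
  · rw [← Onv.pos_lt_pos, Onv.pos_orbAt, Onv.pos_orbAt]; exact hij
  · have e : 2 ^ (i + 1) * c + 2 ^ i = 2 ^ i ^^^ 2 ^ j :=
      calc 2 ^ (i + 1) * c + 2 ^ i = ((2 ^ (i + 1) * c + 2 ^ i) ^^^ 2 ^ i) ^^^ 2 ^ i := by
            rw [Nat.xor_assoc, Nat.xor_self, Nat.xor_zero]
        _ = 2 ^ (i + 1) * c ^^^ 2 ^ i := by rw [Onv.decomp_xor_low]
        _ = 2 ^ j ^^^ 2 ^ i := by rw [hj]
        _ = 2 ^ i ^^^ 2 ^ j := Nat.xor_comm _ _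
    rw [e, Onv.onv_two_pow_xor_two_pow hij hj2]

/-- `#(I \ J) = #(J \ I) ↔ #I = #J`. -/
theorem card_sdiff_eq_iff (I J : Finset (Orb (Fin k))) : (I \ J).card = (J \ I).card ↔ I.card = J.card := by
  have h1 := Finset.card_sdiff_add_card_inter I J
  have h2 := Finset.card_sdiff_add_card_inter J I
  rw [Finset.inter_comm] at h2
  omega

/-! ### Lemmas under the agreement hypothesis `hA`

`hA` says the tables agree with the model `F : Model k` at scale `D`: `B = 2k ≤ 24`, `H = D·h`, `V = D·(··|··)`,
`E = 2D·E_core` (an instance file proves it entry by entry with `decide`). It is a section variable, written out in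
every signature below (no named predicate). -/

variable (hA : T.B = 2 * k ∧ 2 * k ≤ 24 ∧ (∀ p q : Fin k, (T.H p.val q.val : ℚ) = D * F.h p q) ∧
    (∀ p q r s : Fin k, (T.V p.val q.val r.val s.val : ℚ) = D * F.eri p q r s) ∧ (T.E : ℚ) = 2 * D * F.ecore)
include hA

/-- `h1` at positions is `D · F.h1`. -/
theorem h1_pos (P Q : Orb (Fin k)) : (T.h1 (Onv.pos P) (Onv.pos Q) : ℚ) = D * F.h1 P Q := by
  unfold h1 Model.h1
  rw [Onv.pos_mod_two, Onv.pos_mod_two, Onv.pos_div_two, Onv.pos_div_two]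
  by_cases h : (ofLex P).2 = (ofLex Q).2
  · rw [if_pos (by rw [h]), if_pos h, hA.2.2.1]
  · rw [if_neg (fun h' => h (Fin.ext h')), if_neg h, Int.cast_zero, mul_zero]

/-- `g2` at positions is `D · F.g2`. -/
theorem g2_pos (P Q R S : Orb (Fin k)) :
    (T.g2 (Onv.pos P) (Onv.pos Q) (Onv.pos R) (Onv.pos S) : ℚ) = D * F.g2 P Q R S := by
  unfold g2 Model.g2
  rw [Onv.pos_mod_two, Onv.pos_mod_two, Onv.pos_mod_two, Onv.pos_mod_two, Onv.pos_div_two, Onv.pos_div_two,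
    Onv.pos_div_two, Onv.pos_div_two]
  by_cases h : (ofLex P).2 = (ofLex Q).2 ∧ (ofLex R).2 = (ofLex S).2
  · rw [if_pos (by rw [h.1, h.2]; exact ⟨rfl, rfl⟩), if_pos h, hA.2.2.2.1]
  · rw [if_neg (fun h' => h ⟨Fin.ext h'.1, Fin.ext h'.2⟩), if_neg h, Int.cast_zero, mul_zero]

/-- Position loops, cast to `ℚ`, are sums over `onv`. -/
theorem cast_sumPos (s : ℕ) (g : ℕ → ℤ) :
    ((Onv.sumPos s g T.B : ℤ) : ℚ) = ∑ P ∈ Onv.onv k s, ((g (Onv.pos P) : ℤ) : ℚ) := by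
  rw [hA.1, ← Onv.sum_onv_eq_sumPos, Int.cast_sum]

/-- `jwCount` is the Jordan–Wigner count: `(−1)^(jwCount s (2^pos P)) = jwSignQ P (onv s)`. -/
theorem neg_one_pow_jwCount {s : ℕ} (hs : s < 2 ^ (2 * k)) (P : Orb (Fin k)) :
    ((-1 : ℚ)) ^ jwCount s (2 ^ Onv.pos P) = Model.jwSignQ P (Onv.onv k s) := by
  unfold jwCount
  rw [Onv.jwSignQ_onv hA.2.1 hs]

/-- DIAGONAL case. -/
theorem diag_eq (s : ℕ) : (T.diag s : ℚ) = 2 * D * F.scDiag (Onv.onv k s) := by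
  unfold diag Model.scDiag
  push_cast
  rw [cast_sumPos hA, cast_sumPos hA, hA.2.2.2.2]
  have h2 : ∀ P ∈ Onv.onv k s, ((Onv.sumPos s (fun R => T.g2 (Onv.pos P) (Onv.pos P) R R -
      T.g2 (Onv.pos P) R R (Onv.pos P)) T.B : ℤ) : ℚ) =
      D * ∑ R ∈ Onv.onv k s, (F.g2 P P R R - F.g2 P R R P) := by
    intro P _
    rw [cast_sumPos hA, Finset.mul_sum]
    refine Finset.sum_congr rfl fun R _ => ?_
    push_cast
    rw [g2_pos hA, g2_pos hA]; ring
  rw [Finset.sum_congr rfl h2, ← Finset.mul_sum]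
  have h1 : ∀ P ∈ Onv.onv k s, ((T.h1 (Onv.pos P) (Onv.pos P) : ℤ) : ℚ) = D * F.h1 P P :=
    fun P _ => h1_pos hA P P
  rw [Finset.sum_congr rfl h1, ← Finset.mul_sum]
  ring

/-- SINGLE case: `b ∈ J = onv s` emptied, `a` filled. -/
theorem single_eq {s : ℕ} (hs : s < 2 ^ (2 * k)) (a : Orb (Fin k)) {b : Orb (Fin k)}
    (hb : s.testBit (Onv.pos b) = true) :
    (T.single s (2 ^ Onv.pos a) (2 ^ Onv.pos b) : ℚ) = 2 * D * F.scSingle (Onv.onv k s) a b := by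
  have hpa := Onv.pos_lt a
  have hpb := Onv.pos_lt b
  have hk := hA.2.1
  have ia : Onv.idx24 (2 ^ Onv.pos a) = Onv.pos a := Onv.idx24_two_pow ⟨Onv.pos a, by omega⟩
  have ib : Onv.idx24 (2 ^ Onv.pos b) = Onv.pos b := Onv.idx24_two_pow ⟨Onv.pos b, by omega⟩
  have hs1 : s ^^^ 2 ^ Onv.pos b < 2 ^ (2 * k) := Nat.xor_lt_two_pow hs (Nat.pow_lt_pow_right (by norm_num) hpb)
  have he : Onv.onv k (s ^^^ 2 ^ Onv.pos b) = (Onv.onv k s).erase b := by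
    rw [Onv.onv_xor_two_pow_of_mem hpb hb, Onv.orbAt_pos]
  unfold single singleIdx Model.scSingle
  rw [ia, ib]
  push_cast
  rw [cast_sgn, pow_add, neg_one_pow_jwCount hA hs, neg_one_pow_jwCount hA hs1, he, cast_sumPos hA, h1_pos hA]
  have h4 : ∀ R ∈ Onv.onv k s, (((T.g2 (Onv.pos a) (Onv.pos b) (Onv.pos R) (Onv.pos R) +
      T.g2 (Onv.pos R) (Onv.pos R) (Onv.pos a) (Onv.pos b) -
      (T.g2 (Onv.pos a) (Onv.pos R) (Onv.pos R) (Onv.pos b) + T.g2 (Onv.pos R) (Onv.pos b) (Onv.pos a) (Onv.pos R)) :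
        ℤ) : ℚ)) = D * ((F.g2 a b R R + F.g2 R R a b) - (F.g2 a R R b + F.g2 R b a R)) := by
    intro R _
    push_cast
    rw [g2_pos hA, g2_pos hA, g2_pos hA, g2_pos hA]; ring
  rw [Finset.sum_congr rfl h4, ← Finset.mul_sum]
  ring

/-- DOUBLE case: `K, L ∈ onv s` emptied (`K ≠ L`), `I, J ∉ onv s` filled (`I ≠ J`). -/
theorem double_eq {s : ℕ} (hs : s < 2 ^ (2 * k)) {I J K L : Orb (Fin k)}
    (hK : s.testBit (Onv.pos K) = true) (hL : s.testBit (Onv.pos L) = true) (hKL : K ≠ L)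
    (hI : s.testBit (Onv.pos I) = false) (hJ : s.testBit (Onv.pos J) = false) (hIJ : I ≠ J) :
    (T.double s (2 ^ Onv.pos I) (2 ^ Onv.pos J) (2 ^ Onv.pos K) (2 ^ Onv.pos L) : ℚ) =
      2 * D * F.scDouble (Onv.onv k s) I J K L := by
  have hk := hA.2.1
  have hpI := Onv.pos_lt I; have hpJ := Onv.pos_lt J; have hpK := Onv.pos_lt K; have hpL := Onv.pos_lt L
  have iI : Onv.idx24 (2 ^ Onv.pos I) = Onv.pos I := Onv.idx24_two_pow ⟨Onv.pos I, by omega⟩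
  have iJ : Onv.idx24 (2 ^ Onv.pos J) = Onv.pos J := Onv.idx24_two_pow ⟨Onv.pos J, by omega⟩
  have iK : Onv.idx24 (2 ^ Onv.pos K) = Onv.pos K := Onv.idx24_two_pow ⟨Onv.pos K, by omega⟩
  have iL : Onv.idx24 (2 ^ Onv.pos L) = Onv.pos L := Onv.idx24_two_pow ⟨Onv.pos L, by omega⟩
  have nKL : Onv.pos K ≠ Onv.pos L := fun h => hKL (Onv.pos_injective h)
  have nIJ : Onv.pos I ≠ Onv.pos J := fun h => hIJ (Onv.pos_injective h)
  have nIK : Onv.pos I ≠ Onv.pos K := fun h => by rw [h, hK] at hI; exact Bool.noConfusion hI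
  have nIL : Onv.pos I ≠ Onv.pos L := fun h => by rw [h, hL] at hI; exact Bool.noConfusion hI
  have nJK : Onv.pos J ≠ Onv.pos K := fun h => by rw [h, hK] at hJ; exact Bool.noConfusion hJ
  have nJL : Onv.pos J ≠ Onv.pos L := fun h => by rw [h, hL] at hJ; exact Bool.noConfusion hJ
  have lt2 : ∀ {q}, q < 2 * k → 2 ^ q < 2 ^ (2 * k) := fun hq => Nat.pow_lt_pow_right (by norm_num) hq
  unfold double doubleIdx Model.scDouble
  rw [iI, iJ, iK, iL]
  -- the three intermediate masks
  set s1 := s ^^^ 2 ^ Onv.pos K with hs1def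
  set s2 := s1 ^^^ 2 ^ Onv.pos L with hs2def
  set s3 := s2 ^^^ 2 ^ Onv.pos J with hs3def
  have hs1 : s1 < 2 ^ (2 * k) := Nat.xor_lt_two_pow hs (lt2 hpK)
  have hs2 : s2 < 2 ^ (2 * k) := Nat.xor_lt_two_pow hs1 (lt2 hpL)
  have hs3 : s3 < 2 ^ (2 * k) := Nat.xor_lt_two_pow hs2 (lt2 hpJ)
  have bL1 : s1.testBit (Onv.pos L) = true := by
    rw [hs1def, Nat.testBit_xor, hL, Nat.testBit_two_pow_of_ne nKL]; rfl
  have bJ2 : s2.testBit (Onv.pos J) = false := by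
    rw [hs2def, Nat.testBit_xor, hs1def, Nat.testBit_xor, hJ, Nat.testBit_two_pow_of_ne nJK.symm,
      Nat.testBit_two_pow_of_ne nJL.symm]; rfl
  have bI3 : s3.testBit (Onv.pos I) = false := by
    rw [hs3def, Nat.testBit_xor, hs2def, Nat.testBit_xor, hs1def, Nat.testBit_xor, hI,
      Nat.testBit_two_pow_of_ne nIK.symm, Nat.testBit_two_pow_of_ne nIL.symm, Nat.testBit_two_pow_of_ne nIJ.symm]
    rfl
  have e1 : Onv.onv k s1 = (Onv.onv k s).erase K := by
    rw [hs1def, Onv.onv_xor_two_pow_of_mem hpK hK, Onv.orbAt_pos]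
  have e2 : Onv.onv k s2 = ((Onv.onv k s).erase K).erase L := by
    rw [hs2def, Onv.onv_xor_two_pow_of_mem hpL bL1, Onv.orbAt_pos, e1]
  have e3 : Onv.onv k s3 = insert J (((Onv.onv k s).erase K).erase L) := by
    rw [hs3def, Onv.onv_xor_two_pow_of_not_mem hpJ bJ2, Onv.orbAt_pos, e2]
  push_cast
  rw [cast_sgn, pow_add, pow_add, pow_add, neg_one_pow_jwCount hA hs, neg_one_pow_jwCount hA hs1,
    neg_one_pow_jwCount hA hs2, neg_one_pow_jwCount hA hs3, e1, e2, e3, g2_pos hA, g2_pos hA, g2_pos hA, g2_pos hA]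
  ring

end Bridge

end FastTables

end Summit.Ventures.CertifiedQuantumChemistry
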